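import Literature.MathematicalPhysics.QuantumFieldTheory.Multiboson
import HarnessLib

/-!
# Admissible multiboson data, repaired (rev 5, scale-free): `IsAdmissibleMultibosonDataR`

Definition request `defn-IsAdmissibleMultibosonDataR-2` (route
`Summit.QuantumFields.QCD.Theses.MultibosonBridge`, rev 5; wanted by the items
`MultibosonLatticeGapR2` (stmt-QuantumFields-11126) and `GapTransferR2` (stmt-QuantumFields-11127),
whose statements inline the predicate as the `let Adm` of their `let Dm / W / E / Qm / qv / Adm /
Tail / Gap` vocabulary). This file names that `let Adm` VERBATIM, with the route's `qv` replaced by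
its landed name `multibosonModSq` (`Multiboson.lean`; definitionally equal, so the items restate by
`Iff.rfl`, see below), and proves its elementary API. Companion notions are unchanged and imported:
`HasSpectralTailDomination` (the `let Tail`) and `QCDScheme.HasMultibosonLatticeGap` (the `let Gap`).

## Why a third admissibility predicate (history, for reviewers)

* rev 3 — `IsAdmissibleMultibosonData sch ε δ ℓ ν` (`Multiboson.lean`): MONIC filter
  `q(t) = ∏_{z ∈ ν} |t − z|²` and an `ε`-uniform `δ⁻⁸` Chebyshev coefficient certificate. REFUTED as
  a hypothesis (unsatisfiable for every scheme with `N_f ≥ 1`: the monic obstruction of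
  `Summits/QuantumFields/QCD/Theorems/MultibosonBridgeMultibosonLatticeGapRefutation`); kept in the
  tree because it has users, superseded here.
* rev 4 — `IsAdmissibleMultibosonDataR` as requested by `defn-IsAdmissibleMultibosonDataR`
  (items 10697/10698, since replaced in the route file): a NORMALISATION `κ_{k,f} > 0`
  (Lüscher's `c_n`, (4.14)) multiplies the filter, `q(t) = κ ∏ |t − z|²`, and the coefficient
  certificate is replaced by the DEGREE BOUND `|ν_{k,f}| ≤ ℓ_k log(2/δ_k)` (Lüscher (4.16)–(4.17):
  `δ = 2((1−√ε)/(1+√ε))^{n+1}`, so `n ≍ ε^{-1/2} log(2/δ)`); first conjunct still the PHYSICAL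
  locality bound `a_k ℓ_k ≤ ρ`.
* rev 5 (THIS file; the current route text) — identical to rev 4 except that the first conjunct is
  the SCALE-FREE range clause `√ε_k · ℓ_k ≤ ρ`: with `n ≤ ℓ log(2/δ)` roots the Chebyshev filter
  of gap `ε` localises on `≍ ε^{-1/2}` lattice spacings, so the consistent bookkeeping couples `ℓ_k`
  to `ε_k`, not to `a_k` (route calibration memo `calib_memo.md` attached to the request; the
  lattice-unit clause `64 ≤ ε_k ℓ_k²` bounds `√ε_k ℓ_k` from below by `8`). The name
  `IsAdmissibleMultibosonDataR` is the one both requests ask for; the rev-4 shape has no consumer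
  left in the route file, so the name carries the rev-5 body.

## Source (Lüscher 1994) and what the clauses say

M. Lüscher, *A new approach to the problem of dynamical quarks in numerical simulations of lattice
QCD*, Nucl. Phys. B 418 (1994) 637–648, §3 (3.1)–(3.9) (any polynomial `P(s) ≈ 1/s` with
non-real roots bosonises `det Q²`), §4.3 (4.11)–(4.17) (Chebyshev construction on `[ε, 1]`, uniform
relative error `δ`, degree `n`). Per `(k, f)`, with `q(t) = κ_{k,f} ∏_{z ∈ ν_{k,f}} |t − z|²` and
`c = |m_f(k) + 4| + 4` (a bound for `‖D_W(m_f(k))‖`, Lüscher (2.7)): `0 < ε_k`, `0 < δ_k < 1`,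
`ε_k ℓ_k² ≥ 64`, `κ_{k,f} > 0`, `|ν_{k,f}| ≤ ℓ_k log(2/δ_k)`, all roots non-real,
`|t| q(t) ∈ [1 − δ_k, 1 + δ_k]` for `√ε_k c ≤ |t| ≤ c` (accuracy off the gap) and
`|t| q(t) ≤ 1 + δ_k` for `|t| ≤ √ε_k c` (gap bound); globally `√ε_k ℓ_k ≤ ρ` and `δ_k → 0`.
A predicate (hypothesis of the route), not an assertion; its satisfiability per `(k, f)` is route
item `AdmissibleRootsExistR`.

## Contents

* `IsAdmissibleMultibosonDataR sch ε δ ℓ κ ν` — the predicate (binder order as in the items);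
* `isAdmissibleMultibosonDataR_iff` (unfolding), projections `.exists_range_bound`,
  `.tendsto_delta`, `.eps_pos`, `.delta_pos`, `.delta_lt_one`, `.kappa_pos`, `.im_ne_zero`,
  `.sqrt_eps_mul_ell_ge_eight` (`8 ≤ √ε_k ℓ_k`, from `64 ≤ ε_k ℓ_k²`);
* `IsAdmissibleMultibosonDataR.comp_strictMono` — stability under subsequences of the scheme and
  the data (only the field equation `sch'.mq f j = sch.mq f (φ j)` is needed now that the range
  clause is scale-free), matching `HasSpectralTailDomination.comp_strictMono` /
  `HasMultibosonLatticeGap.comp_strictMono` of `Multiboson.lean`.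

Restatement check (done in the proposer's scratch file against the built Theses module, not
shipped): `GapTransferR2 ↔ ∀ Nf sch ε δ p ℓ κ ν Δ, IsAdmissibleMultibosonDataR sch ε δ ℓ κ ν →
HasSpectralTailDomination sch ε p ℓ ν → 0 < Δ → sch.HasMultibosonLatticeGap ν Δ → ∃ Δ', 0 < Δ' ∧
Δ' ≤ Δ ∧ sch.HasLatticeMassGap Δ'` holds by `Iff.rfl`.

NOT here: any assertion of admissibility (route item `AdmissibleRootsExistR`), the refutation of the
rev-3 predicate (prover file named above), changes to `Multiboson.lean`.
-/

open Filter Topology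

noncomputable section

namespace Literature.MathematicalPhysics.QuantumFieldTheory

variable {Nf : ℕ}

/-- **Admissible multiboson data along a lattice QCD scheme, repaired and scale-free (rev 5)** —
the `let Adm` of route items `MultibosonLatticeGapR2` / `GapTransferR2`, VERBATIM with
`qv ↦ multibosonModSq`. For `sch : QCDScheme N_f`, accuracies `ε_k`, tolerances `δ_k`, locality
scales `ℓ_k ∈ ℕ`, normalisations `κ_{k,f}` and root lists `ν_{k,f}`, writing
`q(t) = κ_{k,f} · multibosonModSq (ν k f) t = κ_{k,f} ∏_{z ∈ ν_{k,f}} |t − z|²` and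
`c = |m_f(k) + 4| + 4`: the scale-free range is bounded, `√ε_k ℓ_k ≤ ρ`; `δ_k → 0`; and for every
`(k, f)`: `0 < ε_k`, `0 < δ_k < 1`, `ε_k ℓ_k² ≥ 64`, `0 < κ_{k,f}`, the degree bound
`|ν_{k,f}| ≤ ℓ_k log(2/δ_k)` (Lüscher 1994, (4.16)–(4.17): relative error
`δ = 2((1−√ε)/(1+√ε))^{n+1}` of the degree-`n` Chebyshev approximation of `1/s` on `[ε, 1]`), all
roots non-real (loc. cit. §3: "none of the roots `z_k` of the polynomial are real"),
`|t| q(t) ∈ [1 − δ_k, 1 + δ_k]` for `√ε_k c ≤ |t| ≤ c` and `|t| q(t) ≤ 1 + δ_k` for `|t| ≤ √ε_k c`.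
A predicate (hypothesis of the route), not an assertion; supersedes the refuted rev-3
`IsAdmissibleMultibosonData` (monic filter) — see the module docstring for the rev-3/4/5 history.
[cite: Luscher1994, §4.3 (4.11)–(4.17)] -/
def IsAdmissibleMultibosonDataR (sch : QCDScheme Nf) (ε δ : ℕ → ℝ) (ℓ : ℕ → ℕ)
    (κ : ℕ → Fin Nf → ℝ) (ν : ℕ → Fin Nf → List ℂ) : Prop :=
  (∃ ρ : ℝ, ∀ k, Real.sqrt (ε k) * ℓ k ≤ ρ) ∧ Tendsto δ atTop (𝓝 0) ∧
    ∀ (k : ℕ) (f : Fin Nf), 0 < ε k ∧ 0 < δ k ∧ δ k < 1 ∧ 64 ≤ ε k * (ℓ k : ℝ) ^ 2 ∧ 0 < κ k f ∧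
      ((ν k f).length : ℝ) ≤ (ℓ k : ℝ) * Real.log (2 / δ k) ∧ (∀ z ∈ ν k f, z.im ≠ 0) ∧
      (∀ t : ℝ, Real.sqrt (ε k) * (|sch.mq f k + 4| + 4) ≤ |t| → |t| ≤ (|sch.mq f k + 4| + 4) →
        |t| * (κ k f * multibosonModSq (ν k f) t) - 1 ≤ δ k ∧
          1 - |t| * (κ k f * multibosonModSq (ν k f) t) ≤ δ k) ∧
      (∀ t : ℝ, |t| ≤ Real.sqrt (ε k) * (|sch.mq f k + 4| + 4) →
        |t| * (κ k f * multibosonModSq (ν k f) t) ≤ 1 + δ k)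

/-- Unfolding `IsAdmissibleMultibosonDataR` (by definition). [folklore] -/
theorem isAdmissibleMultibosonDataR_iff (sch : QCDScheme Nf) (ε δ : ℕ → ℝ) (ℓ : ℕ → ℕ)
    (κ : ℕ → Fin Nf → ℝ) (ν : ℕ → Fin Nf → List ℂ) :
    IsAdmissibleMultibosonDataR sch ε δ ℓ κ ν ↔
      (∃ ρ : ℝ, ∀ k, Real.sqrt (ε k) * ℓ k ≤ ρ) ∧ Tendsto δ atTop (𝓝 0) ∧
        ∀ (k : ℕ) (f : Fin Nf), 0 < ε k ∧ 0 < δ k ∧ δ k < 1 ∧ 64 ≤ ε k * (ℓ k : ℝ) ^ 2 ∧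
          0 < κ k f ∧ ((ν k f).length : ℝ) ≤ (ℓ k : ℝ) * Real.log (2 / δ k) ∧
          (∀ z ∈ ν k f, z.im ≠ 0) ∧
          (∀ t : ℝ, Real.sqrt (ε k) * (|sch.mq f k + 4| + 4) ≤ |t| →
            |t| ≤ (|sch.mq f k + 4| + 4) →
            |t| * (κ k f * multibosonModSq (ν k f) t) - 1 ≤ δ k ∧
              1 - |t| * (κ k f * multibosonModSq (ν k f) t) ≤ δ k) ∧
          (∀ t : ℝ, |t| ≤ Real.sqrt (ε k) * (|sch.mq f k + 4| + 4) →
            |t| * (κ k f * multibosonModSq (ν k f) t) ≤ 1 + δ k) :=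
  Iff.rfl

namespace IsAdmissibleMultibosonDataR

variable {sch : QCDScheme Nf} {ε δ : ℕ → ℝ} {ℓ : ℕ → ℕ} {κ : ℕ → Fin Nf → ℝ}
  {ν : ℕ → Fin Nf → List ℂ}

/-- The scale-free range `√ε_k ℓ_k` is bounded along the scheme. [folklore] -/
theorem exists_range_bound (h : IsAdmissibleMultibosonDataR sch ε δ ℓ κ ν) :
    ∃ ρ : ℝ, ∀ k, Real.sqrt (ε k) * ℓ k ≤ ρ :=
  h.1

/-- The tolerances tend to zero. [folklore] -/
theorem tendsto_delta (h : IsAdmissibleMultibosonDataR sch ε δ ℓ κ ν) : Tendsto δ atTop (𝓝 0) :=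
  h.2.1

/-- `0 < ε_k`. [folklore] -/
theorem eps_pos (h : IsAdmissibleMultibosonDataR sch ε δ ℓ κ ν) (k : ℕ) (f : Fin Nf) : 0 < ε k :=
  (h.2.2 k f).1

/-- `0 < δ_k`. [folklore] -/
theorem delta_pos (h : IsAdmissibleMultibosonDataR sch ε δ ℓ κ ν) (k : ℕ) (f : Fin Nf) :
    0 < δ k :=
  (h.2.2 k f).2.1

/-- `δ_k < 1`. [folklore] -/
theorem delta_lt_one (h : IsAdmissibleMultibosonDataR sch ε δ ℓ κ ν) (k : ℕ) (f : Fin Nf) :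
    δ k < 1 :=
  (h.2.2 k f).2.2.1

/-- `64 ≤ ε_k ℓ_k²` (the filter localises on at least `8` lattice spacings). [folklore] -/
theorem sixty_four_le (h : IsAdmissibleMultibosonDataR sch ε δ ℓ κ ν) (k : ℕ) (f : Fin Nf) :
    64 ≤ ε k * (ℓ k : ℝ) ^ 2 :=
  (h.2.2 k f).2.2.2.1

/-- `0 < κ_{k,f}` (the normalisation of the filter). [folklore] -/
theorem kappa_pos (h : IsAdmissibleMultibosonDataR sch ε δ ℓ κ ν) (k : ℕ) (f : Fin Nf) :
    0 < κ k f :=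
  (h.2.2 k f).2.2.2.2.1

/-- The degree bound `|ν_{k,f}| ≤ ℓ_k log(2/δ_k)`. [cite: Luscher1994, §4.3 (4.16)–(4.17)] -/
theorem length_le (h : IsAdmissibleMultibosonDataR sch ε δ ℓ κ ν) (k : ℕ) (f : Fin Nf) :
    ((ν k f).length : ℝ) ≤ (ℓ k : ℝ) * Real.log (2 / δ k) :=
  (h.2.2 k f).2.2.2.2.2.1

/-- All roots are non-real. [cite: Luscher1994, §3 (after (3.9))] -/
theorem im_ne_zero (h : IsAdmissibleMultibosonDataR sch ε δ ℓ κ ν) (k : ℕ) (f : Fin Nf) {z : ℂ}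
    (hz : z ∈ ν k f) : z.im ≠ 0 :=
  (h.2.2 k f).2.2.2.2.2.2.1 z hz

/-- Accuracy off the gap: `|t| q(t) ∈ [1 − δ_k, 1 + δ_k]` for `√ε_k c ≤ |t| ≤ c`,
`c = |m_f(k) + 4| + 4`. [cite: Luscher1994, §4.3 (4.11)–(4.15)] -/
theorem accuracy (h : IsAdmissibleMultibosonDataR sch ε δ ℓ κ ν) (k : ℕ) (f : Fin Nf) {t : ℝ}
    (h₁ : Real.sqrt (ε k) * (|sch.mq f k + 4| + 4) ≤ |t|) (h₂ : |t| ≤ |sch.mq f k + 4| + 4) :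
    |t| * (κ k f * multibosonModSq (ν k f) t) - 1 ≤ δ k ∧
      1 - |t| * (κ k f * multibosonModSq (ν k f) t) ≤ δ k :=
  (h.2.2 k f).2.2.2.2.2.2.2.1 t h₁ h₂

/-- Gap bound: `|t| q(t) ≤ 1 + δ_k` for `|t| ≤ √ε_k c`. [cite: Luscher1994, §4.3 (4.11)–(4.15)] -/
theorem gap_bound (h : IsAdmissibleMultibosonDataR sch ε δ ℓ κ ν) (k : ℕ) (f : Fin Nf) {t : ℝ}
    (ht : |t| ≤ Real.sqrt (ε k) * (|sch.mq f k + 4| + 4)) :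
    |t| * (κ k f * multibosonModSq (ν k f) t) ≤ 1 + δ k :=
  (h.2.2 k f).2.2.2.2.2.2.2.2 t ht

/-- `8 ≤ √ε_k ℓ_k` whenever flavours exist: the scale-free range is bounded below by the
lattice-unit clause `64 ≤ ε_k ℓ_k²`. [folklore] -/
theorem eight_le_sqrt_eps_mul (h : IsAdmissibleMultibosonDataR sch ε δ ℓ κ ν) (k : ℕ)
    (f : Fin Nf) : 8 ≤ Real.sqrt (ε k) * ℓ k := by
  have h64 := h.sixty_four_le k f
  have hε := (h.eps_pos k f).le
  have hℓ : (0 : ℝ) ≤ ℓ k := Nat.cast_nonneg _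
  have hsq : Real.sqrt (ε k * (ℓ k : ℝ) ^ 2) = Real.sqrt (ε k) * ℓ k := by
    rw [Real.sqrt_mul hε, Real.sqrt_sq hℓ]
  calc (8 : ℝ) = Real.sqrt 64 := by rw [show (64 : ℝ) = 8 ^ 2 by norm_num, Real.sqrt_sq (by norm_num)]
    _ ≤ Real.sqrt (ε k * (ℓ k : ℝ) ^ 2) := Real.sqrt_le_sqrt h64
    _ = Real.sqrt (ε k) * ℓ k := hsq

/-- **Admissibility (rev 5) is stable under subsequences**: restricting the scheme's quark masses
and the data `ε, δ, ℓ, κ, ν` along a strictly increasing `φ` preserves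
`IsAdmissibleMultibosonDataR` (a tail property; only the field equation
`sch'.mq f j = sch.mq f (φ j)` of the sub-scheme is used, the range clause being scale-free).
[folklore] -/
theorem comp_strictMono {sch' : QCDScheme Nf} (h : IsAdmissibleMultibosonDataR sch ε δ ℓ κ ν)
    {φ : ℕ → ℕ} (hφ : StrictMono φ) (hmq : ∀ f j, sch'.mq f j = sch.mq f (φ j)) :
    IsAdmissibleMultibosonDataR sch' (ε ∘ φ) (δ ∘ φ) (ℓ ∘ φ) (κ ∘ φ) (ν ∘ φ) := by
  obtain ⟨⟨ρ, hρ⟩, hδ, hk⟩ := h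
  refine ⟨⟨ρ, fun j => hρ (φ j)⟩, hδ.comp hφ.tendsto_atTop, fun j f => ?_⟩
  simpa only [Function.comp_apply, hmq] using hk (φ j) f

end IsAdmissibleMultibosonDataR

/-! ### Further API: the uniform filter bound, positivity of the bosonised weight, non-vacuity
(appended for the provers of `GapTransferR2` / `ReweightingIdentity`; theorems only) -/

namespace IsAdmissibleMultibosonDataR

variable {sch : QCDScheme Nf} {ε δ : ℕ → ℝ} {ℓ : ℕ → ℕ} {κ : ℕ → Fin Nf → ℝ}
  {ν : ℕ → Fin Nf → List ℂ}

/-- **Uniform bound on the whole spectral interval**: `|t| q(t) ≤ 1 + δ_k` for ALL `|t| ≤ c`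
(`c = |m_f(k) + 4| + 4`; gap bound below `√ε_k c`, accuracy above) — the estimate behind
`|R| ≤ (1 + δ_k)^N` for the exact correction factor `R = ∏_f ∏_i λ_{f,i} q_f(λ_{f,i})` of route item
`GapTransferR2`. [folklore] -/
theorem mul_le_one_add (h : IsAdmissibleMultibosonDataR sch ε δ ℓ κ ν) (k : ℕ) (f : Fin Nf)
    {t : ℝ} (ht : |t| ≤ |sch.mq f k + 4| + 4) :
    |t| * (κ k f * multibosonModSq (ν k f) t) ≤ 1 + δ k := by
  by_cases hlt : Real.sqrt (ε k) * (|sch.mq f k + 4| + 4) ≤ |t|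
  · have := (h.accuracy k f hlt ht).1
    linarith
  · exact h.gap_bound k f (le_of_lt (not_le.mp hlt))

/-- The filter value is non-negative and at most `(1 + δ_k)/|t|`-controlled: `0 ≤ |t| q(t)`.
[folklore] -/
theorem mul_nonneg (h : IsAdmissibleMultibosonDataR sch ε δ ℓ κ ν) (k : ℕ) (f : Fin Nf) (t : ℝ) :
    0 ≤ |t| * (κ k f * multibosonModSq (ν k f) t) :=
  _root_.mul_nonneg (abs_nonneg t)
    (_root_.mul_nonneg (h.kappa_pos k f).le (multibosonModSq_nonneg _ _))

/-- All roots non-real, in the shape `∀ f, ∀ z ∈ ν k f, Im z ≠ 0` consumed by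
`multibosonWeight_pos`, `integral_multibosonWeight_pos`, `multibosonExpect_one`. [folklore] -/
theorem forall_im_ne_zero (h : IsAdmissibleMultibosonDataR sch ε δ ℓ κ ν) (k : ℕ) :
    ∀ f, ∀ z ∈ ν k f, z.im ≠ 0 :=
  fun f _ hz => h.im_ne_zero k f hz

/-- **The bosonised weight of admissible data is positive**: `0 < W(U)` on every torus, for every
gauge field and at every step `k` (all roots are non-real; `multibosonWeight_pos`). [folklore] -/
theorem weight_pos (h : IsAdmissibleMultibosonDataR sch ε δ ℓ κ ν) (k S : ℕ) [NeZero S]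
    (U : GaugeConfig 4 S (Matrix.specialUnitaryGroup (Fin 3) ℂ)) :
    0 < multibosonWeight S (fun f => sch.mq f k) (ν k) U :=
  multibosonWeight_pos S _ (h.forall_im_ne_zero k) U

/-- **The bosonised expectation of admissible data is normalised**: `E^bos[1] = 1` at every step
`k`, on every torus and at every inverse coupling `β` (`multibosonExpect_one`). [folklore] -/
theorem expect_one (h : IsAdmissibleMultibosonDataR sch ε δ ℓ κ ν) (k S : ℕ) [NeZero S] (β : ℝ) :
    multibosonExpect S β (fun f => sch.mq f k) (ν k) (fun _ => 1) = 1 :=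
  multibosonExpect_one S β _ (h.forall_im_ne_zero k)

end IsAdmissibleMultibosonDataR

/-- **Where the content is (a degenerate inhabitant; non-vacuity of the predicate).** With EMPTY
root lists, `ε ≡ 1`, `ℓ ≡ 8`, `κ_{k,f} = 1/c` (`c = |m_f(k) + 4| + 4`) and any tolerances
`δ_k ∈ (0, 1)` with `δ_k → 0`, the predicate holds along EVERY scheme: `√1 · 8 ≤ 8`, `1 · 8² = 64`,
`0 ≤ 8 log(2/δ_k)`, and for `ε_k = 1` the accuracy window `√ε_k c ≤ |t| ≤ c` is the single shell
`|t| = c`, where `|t| · (1/c) · 1 = 1`, while below it `|t|/c ≤ 1 ≤ 1 + δ_k`. So admissibility ALONE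
is cheap (and `W ≡ 1`, `E^bos` = the quenched Wilson expectation for such data): no upper bound on
`ε_k` is part of the predicate, smallness of `ε_k` being demanded only through
`HasSpectralTailDomination`; the route's content is the conjunction `Adm ∧ Tail ∧ ∃ Δ > 0, Gap Δ`.
Non-trivial root lists per `(k, f)` (small `ε`) are route item `AdmissibleRootsExistR`. [folklore] -/
theorem isAdmissibleMultibosonDataR_nil (sch : QCDScheme Nf) {δ : ℕ → ℝ} (hδ0 : ∀ k, 0 < δ k)
    (hδ1 : ∀ k, δ k < 1) (hδ : Tendsto δ atTop (𝓝 0)) :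
    IsAdmissibleMultibosonDataR sch (fun _ => 1) δ (fun _ => 8)
      (fun k f => (|sch.mq f k + 4| + 4)⁻¹) (fun _ _ => []) := by
  refine ⟨⟨8, fun k => ?_⟩, hδ, fun k f => ?_⟩
  · dsimp only
    rw [Real.sqrt_one, one_mul]
    push_cast
    exact le_rfl
  have hc : 0 < |sch.mq f k + 4| + 4 := by positivity
  have hlog : 0 ≤ Real.log (2 / δ k) :=
    Real.log_nonneg (by rw [le_div_iff₀ (hδ0 k)]; linarith [hδ1 k])
  refine ⟨one_pos, hδ0 k, hδ1 k, by norm_num, inv_pos.mpr hc, ?_, fun z hz => ?_,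
    fun t h₁ h₂ => ?_, fun t ht => ?_⟩
  · simp only [List.length_nil, Nat.cast_zero, Nat.cast_ofNat]
    exact _root_.mul_nonneg (by norm_num) hlog
  · simp at hz
  · dsimp only at h₁ h₂ ⊢
    rw [Real.sqrt_one, one_mul] at h₁
    have ht : |t| = |sch.mq f k + 4| + 4 := le_antisymm h₂ h₁
    rw [multibosonModSq_nil, mul_one, ht, mul_inv_cancel₀ hc.ne']
    constructor <;> linarith [hδ0 k]
  · dsimp only at ht ⊢
    rw [Real.sqrt_one, one_mul] at ht
    rw [multibosonModSq_nil, mul_one]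
    have h1 : |t| * (|sch.mq f k + 4| + 4)⁻¹ ≤ 1 := by
      rw [mul_inv_le_iff₀ hc, one_mul]
      exact ht
    linarith [hδ0 k]

end Literature.MathematicalPhysics.QuantumFieldTheory

end
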